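import Summits.Parity.BatemanHorn.Theorems.SoloInformedRootCountGamma
import Summits.Parity.BatemanHorn.Theorems.SoloInformedDivisorPairingStorey
import Literature.NumberTheory.Sieve.PowerfulPartDecomposition
import HarnessLib

/-!
# The squarefree · squarefull decomposition of the level `∑_{d ≤ x} ρ_g(d)/d`

Solo informed line (Parity / Bateman–Horn), session 136.  Writing every `n ≥ 1` uniquely as
`n = k u` with `k = powerfulPart n` squarefull, `u = exactPart n` squarefree and `(k, u) = 1`
(tree: `Literature.NumberTheory.Sieve.PowerfulPartDecomposition`), multiplicativity of `ρ_g`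
gives the exact decomposition of the small level of `SoloInformedDivisorPairingStorey`,

  `polySmallLevel g x = ∑_{k ≤ x squarefull} (ρ_g(k)/k) · polySqfreeLevel g k ⌊x/k⌋`

(`polySmallLevel_eq_sum_sqfull`), where `polySqfreeLevel g k y = ∑_{u ≤ y, μ²=1, (u,k)=1} ρ_g(u)/u`
is the squarefree level of `SoloInformedRootCountGamma`.  The squarefull weights are summable
with room to spare: from the tree's uniform prime-power bound `ρ_g(p^a) ≤ deg g · M_g`
(`exists_polyRootCountMod_prime_pow_le`) we get the crude divisor-type bound
`ρ_g(k) ≤ C_g k^{1/8}` (`exists_polyRootCountMod_le_rpow`), whence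
`ρ_g(k)(1 + log k)/k ≤ 9 C_g k^{−3/4}` and, by the tree's `∑_{k ≤ Z squarefull} ≤ ∑_{c,a ≤ Z} (c²a³)`
comparison, `∑_{k ≤ Z squarefull} ρ_g(k)(1 + log k)/k ≤ 81 C_g` uniformly in `Z`
(`exists_sum_sqfull_rootCount_weight_le`).  Finally `|log ⌊x/k⌋ − (log x − log k)| ≤ log 2` for
`1 ≤ k ≤ x` (`abs_log_nat_div_sub_le`).  These feed `SoloInformedRootCountLevel.lean`.
-/

noncomputable section

open Finset Real Polynomial Filter Topology

namespace Summit.Parity.BatemanHorn.Theorems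

open Literature.NumberTheory.Sieve

/-! ### A crude bound `ρ_g(k) ≤ C k^{1/8}` -/

/-- Per prime power: `ρ_g(p^a) ≤ B · (p^a)^{1/8}` for `p < B⁸` and `ρ_g(p^a) ≤ (p^a)^{1/8}` for
`p ≥ B⁸`, given the uniform bound `ρ_g(p^a) ≤ B`. [this work] -/
theorem polyRootCountMod_prime_pow_le_rpow (g : ℤ[X]) {B : ℕ}
    (hbd : ∀ p : ℕ, p.Prime → ∀ a : ℕ, polyRootCountMod ![g] (p ^ a) ≤ B)
    {p : ℕ} (hp : p.Prime) {a : ℕ} (ha : a ≠ 0) :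
    (polyRootCountMod ![g] (p ^ a) : ℝ) ≤
      (if p < B ^ 8 then (B : ℝ) else 1) * (((p ^ a : ℕ) : ℝ)) ^ (1 / 8 : ℝ) := by
  have hpa1 : (1 : ℝ) ≤ ((p ^ a : ℕ) : ℝ) := by exact_mod_cast Nat.one_le_pow a p hp.pos
  have hone : (1 : ℝ) ≤ (((p ^ a : ℕ) : ℝ)) ^ (1 / 8 : ℝ) := Real.one_le_rpow hpa1 (by norm_num)
  have hρ : (polyRootCountMod ![g] (p ^ a) : ℝ) ≤ B := by exact_mod_cast hbd p hp a
  have hB0 : (0 : ℝ) ≤ B := Nat.cast_nonneg _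
  split_ifs with hlt
  · calc (polyRootCountMod ![g] (p ^ a) : ℝ) ≤ B := hρ
      _ = (B : ℝ) * 1 := (mul_one _).symm
      _ ≤ (B : ℝ) * (((p ^ a : ℕ) : ℝ)) ^ (1 / 8 : ℝ) := mul_le_mul_of_nonneg_left hone hB0
  · rw [one_mul]
    rw [not_lt] at hlt
    have h1 : ((B : ℝ) ^ 8) ^ (1 / 8 : ℝ) = B := by
      rw [show (1 / 8 : ℝ) = ((8 : ℕ) : ℝ)⁻¹ by norm_num]
      exact Real.pow_rpow_inv_natCast hB0 (by norm_num)
    have h2 : (B : ℝ) ^ 8 ≤ ((p ^ a : ℕ) : ℝ) := by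
      have : B ^ 8 ≤ p ^ a := hlt.trans (Nat.le_self_pow ha p)
      exact_mod_cast this
    calc (polyRootCountMod ![g] (p ^ a) : ℝ) ≤ B := hρ
      _ = ((B : ℝ) ^ 8) ^ (1 / 8 : ℝ) := h1.symm
      _ ≤ (((p ^ a : ℕ) : ℝ)) ^ (1 / 8 : ℝ) := Real.rpow_le_rpow (by positivity) h2 (by norm_num)

/-- **Crude divisor-type bound.**  For `g` irreducible of positive degree there is `C ≥ 0` with
`ρ_g(k) ≤ C k^{1/8}` for all `k`. (From the tree's `ρ_g(p^a) ≤ deg g · M_g`.) [this work] -/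
theorem exists_polyRootCountMod_le_rpow {g : ℤ[X]} (hirr : Irreducible g)
    (hdeg : 0 < g.natDegree) :
    ∃ C : ℝ, 0 ≤ C ∧ ∀ k : ℕ, (polyRootCountMod ![g] k : ℝ) ≤ C * (k : ℝ) ^ (1 / 8 : ℝ) := by
  obtain ⟨M, hM1, hM⟩ := exists_polyRootCountMod_prime_pow_le hirr hdeg
  set B : ℕ := g.natDegree * M with hBdef
  have hB : 1 ≤ B := Nat.succ_le_of_lt (Nat.mul_pos hdeg hM1)
  set T : ℕ := B ^ 8 with hTdef
  refine ⟨(B : ℝ) ^ T, by positivity, fun k => ?_⟩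
  rcases eq_or_ne k 0 with rfl | hk
  · rw [polyRootCountMod_zero]
    simp
  · rw [polyRootCountMod_eq_prod_primeFactors g hk, Nat.cast_prod]
    have hfac : ∀ p ∈ k.primeFactors,
        (polyRootCountMod ![g] (p ^ k.factorization p) : ℝ) ≤
          (if p < T then (B : ℝ) else 1) * (((p ^ k.factorization p : ℕ) : ℝ)) ^ (1 / 8 : ℝ) := by
      intro p hp
      have hpp := Nat.prime_of_mem_primeFactors hp
      have ha : k.factorization p ≠ 0 :=
        (hpp.factorization_pos_of_dvd hk (Nat.dvd_of_mem_primeFactors hp)).ne'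
      exact polyRootCountMod_prime_pow_le_rpow g (fun p hp a => hM p hp a) hpp ha
    have hprod : ∏ p ∈ k.primeFactors, (((p ^ k.factorization p : ℕ) : ℝ)) ^ (1 / 8 : ℝ) =
        (∏ p ∈ k.primeFactors, ((p ^ k.factorization p : ℕ) : ℝ)) ^ (1 / 8 : ℝ) :=
      Real.finsetProd_rpow _ _ (fun p _ => Nat.cast_nonneg _) _
    have hk' : ∏ p ∈ k.primeFactors, p ^ k.factorization p = k := by
      conv_rhs => rw [← Nat.prod_factorization_pow_eq_self hk]
      rw [Finsupp.prod, Nat.support_factorization]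
    have hB1 : (1 : ℝ) ≤ B := by exact_mod_cast hB
    calc ∏ p ∈ k.primeFactors, (polyRootCountMod ![g] (p ^ k.factorization p) : ℝ)
        ≤ ∏ p ∈ k.primeFactors,
            ((if p < T then (B : ℝ) else 1) * (((p ^ k.factorization p : ℕ) : ℝ)) ^ (1 / 8 : ℝ)) :=
          Finset.prod_le_prod (fun p _ => Nat.cast_nonneg _) hfac
      _ = (∏ p ∈ k.primeFactors, (if p < T then (B : ℝ) else 1)) * (k : ℝ) ^ (1 / 8 : ℝ) := by
          rw [Finset.prod_mul_distrib, hprod, ← Nat.cast_prod, hk']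
      _ ≤ (B : ℝ) ^ T * (k : ℝ) ^ (1 / 8 : ℝ) := by
          apply mul_le_mul_of_nonneg_right _ (by positivity)
          rw [Finset.prod_ite, Finset.prod_const_one, mul_one, Finset.prod_const]
          apply pow_le_pow_right₀ hB1
          calc (k.primeFactors.filter (fun p => p < T)).card ≤ (Finset.range T).card :=
                Finset.card_le_card fun p hp => Finset.mem_range.2 (Finset.mem_filter.1 hp).2
            _ = T := Finset.card_range T

/-! ### Squarefull weights -/

/-- `1 + log r ≤ 9 r^{1/8}` for `r ≥ 1`. [folklore] -/
theorem one_add_log_le_nine_rpow {r : ℝ} (hr : 1 ≤ r) :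
    1 + Real.log r ≤ 9 * r ^ (1 / 8 : ℝ) := by
  have h1 : Real.log r ≤ r ^ (1 / 8 : ℝ) / (1 / 8) :=
    Real.log_le_rpow_div (by linarith) (by norm_num)
  have h2 : (1 : ℝ) ≤ r ^ (1 / 8 : ℝ) := Real.one_le_rpow hr (by norm_num)
  have h3 : r ^ (1 / 8 : ℝ) / (1 / 8) = 8 * r ^ (1 / 8 : ℝ) := by ring
  linarith

/-- `ρ_g(k)(1 + log k)/k ≤ 9 C k^{−3/4}` for `k ≥ 1`, given `ρ_g(k) ≤ C k^{1/8}`. [this work] -/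
theorem rootCount_weight_le {g : ℤ[X]} {C : ℝ} (hC : 0 ≤ C)
    (hρ : ∀ k : ℕ, (polyRootCountMod ![g] k : ℝ) ≤ C * (k : ℝ) ^ (1 / 8 : ℝ)) {k : ℕ}
    (hk : 1 ≤ k) :
    (polyRootCountMod ![g] k : ℝ) * (1 + Real.log k) / k ≤ 9 * C * (k : ℝ) ^ (-(3 / 4 : ℝ)) := by
  have hk1 : (1 : ℝ) ≤ k := by exact_mod_cast hk
  have hk0 : (0 : ℝ) < k := by linarith
  have h1 := one_add_log_le_nine_rpow hk1
  have h2 := hρ k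
  have hlog : 0 ≤ 1 + Real.log k := by
    have := Real.log_nonneg hk1
    linarith
  have hprod : (polyRootCountMod ![g] k : ℝ) * (1 + Real.log k) ≤
      (C * (k : ℝ) ^ (1 / 8 : ℝ)) * (9 * (k : ℝ) ^ (1 / 8 : ℝ)) :=
    mul_le_mul h2 h1 hlog (by positivity)
  have hsq : (k : ℝ) ^ (1 / 8 : ℝ) * (k : ℝ) ^ (1 / 8 : ℝ) = (k : ℝ) ^ (1 / 4 : ℝ) := by
    rw [← Real.rpow_add hk0]
    norm_num
  have h34 : (k : ℝ) ^ (-(3 / 4 : ℝ)) = (k : ℝ) ^ (1 / 4 : ℝ) / k := by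
    rw [show (-(3 / 4 : ℝ)) = 1 / 4 - 1 by norm_num, Real.rpow_sub_one hk0.ne']
  rw [div_le_iff₀ hk0, h34]
  calc (polyRootCountMod ![g] k : ℝ) * (1 + Real.log k)
      ≤ (C * (k : ℝ) ^ (1 / 8 : ℝ)) * (9 * (k : ℝ) ^ (1 / 8 : ℝ)) := hprod
    _ = 9 * C * ((k : ℝ) ^ (1 / 8 : ℝ) * (k : ℝ) ^ (1 / 8 : ℝ)) := by ring
    _ = 9 * C * (k : ℝ) ^ (1 / 4 : ℝ) := by rw [hsq]
    _ = 9 * C * ((k : ℝ) ^ (1 / 4 : ℝ) / k) * k := by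
        field_simp

/-- `∑_{k ≤ Z squarefull} k^{−3/4} ≤ 9`. [folklore] -/
theorem sum_sqfull_rpow_le_nine (Z : ℕ) :
    ∑ k ∈ (Icc 1 Z).filter (fun k : ℕ => ∀ p ∈ k.primeFactors, p ^ 2 ∣ k),
      (k : ℝ) ^ (-(3 / 4 : ℝ)) ≤ 9 := by
  have h1 := PowerfulPart.sum_filter_squarefull_le Z
    (g := fun k : ℕ => (k : ℝ) ^ (-(3 / 4 : ℝ))) (fun k => by positivity)
  refine h1.trans ((Finset.sum_le_sum fun c hc => Finset.sum_le_sum fun a ha => ?_).trans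
    (PowerfulPart.sum_box_le_nine Z))
  exact PowerfulPart.rpow_neg_three_quarters_le (Finset.mem_Icc.1 hc).1 (Finset.mem_Icc.1 ha).1

/-- **Squarefull weights are uniformly summable**: there is `W ≥ 0` with
`∑_{k ≤ Z squarefull} ρ_g(k)(1 + log k)/k ≤ W` for all `Z`. [this work] -/
theorem exists_sum_sqfull_rootCount_weight_le {g : ℤ[X]} (hirr : Irreducible g)
    (hdeg : 0 < g.natDegree) :
    ∃ W : ℝ, 0 ≤ W ∧ ∀ Z : ℕ,
      ∑ k ∈ (Icc 1 Z).filter (fun k : ℕ => ∀ p ∈ k.primeFactors, p ^ 2 ∣ k),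
        (polyRootCountMod ![g] k : ℝ) * (1 + Real.log k) / k ≤ W := by
  obtain ⟨C, hC, hρ⟩ := exists_polyRootCountMod_le_rpow hirr hdeg
  refine ⟨9 * C * 9, by positivity, fun Z => ?_⟩
  calc ∑ k ∈ (Icc 1 Z).filter (fun k : ℕ => ∀ p ∈ k.primeFactors, p ^ 2 ∣ k),
        (polyRootCountMod ![g] k : ℝ) * (1 + Real.log k) / k
      ≤ ∑ k ∈ (Icc 1 Z).filter (fun k : ℕ => ∀ p ∈ k.primeFactors, p ^ 2 ∣ k),
          9 * C * (k : ℝ) ^ (-(3 / 4 : ℝ)) :=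
        Finset.sum_le_sum fun k hk =>
          rootCount_weight_le hC hρ (Finset.mem_Icc.1 (Finset.mem_filter.1 hk).1).1
    _ = 9 * C * ∑ k ∈ (Icc 1 Z).filter (fun k : ℕ => ∀ p ∈ k.primeFactors, p ^ 2 ∣ k),
          (k : ℝ) ^ (-(3 / 4 : ℝ)) := by rw [Finset.mul_sum]
    _ ≤ 9 * C * 9 := mul_le_mul_of_nonneg_left (sum_sqfull_rpow_le_nine Z) (by positivity)

/-! ### The decomposition `n = powerfulPart n · exactPart n` applied to the level -/

/-- `powerfulPart n` is a squarefull number in `[1, x]` for `n ∈ [1, x]`. [folklore] -/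
theorem powerfulPart_mem_filter_sqfull {x n : ℕ} (hn : n ∈ Icc 1 x) :
    PowerfulPart.powerfulPart n ∈
      (Icc 1 x).filter (fun k : ℕ => ∀ p ∈ k.primeFactors, p ^ 2 ∣ k) := by
  obtain ⟨h1, h2⟩ := Finset.mem_Icc.1 hn
  have hn0 : n ≠ 0 := by omega
  refine Finset.mem_filter.2 ⟨Finset.mem_Icc.2 ⟨PowerfulPart.powerfulPart_pos hn0, ?_⟩,
    fun p hp => ?_⟩
  · exact (Nat.le_of_dvd (by omega) (PowerfulPart.powerfulPart_dvd n)).trans h2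
  · exact PowerfulPart.sq_dvd_powerfulPart_of_dvd (Nat.prime_of_mem_primeFactors hp)
      (Nat.dvd_of_mem_primeFactors hp)

/-- The fibre of `powerfulPart` over a squarefull `k ≤ x`:
`∑_{n ≤ x, powerfulPart n = k} ρ_g(n)/n = (ρ_g(k)/k) · polySqfreeLevel g k ⌊x/k⌋`. [this work] -/
theorem sum_fiber_powerfulPart_eq (g : ℤ[X]) {x k : ℕ}
    (hk : k ∈ (Icc 1 x).filter (fun k : ℕ => ∀ p ∈ k.primeFactors, p ^ 2 ∣ k)) :
    ∑ n ∈ (Icc 1 x).filter (fun n => PowerfulPart.powerfulPart n = k),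
        (polyRootCountMod ![g] n : ℝ) / n =
      (polyRootCountMod ![g] k : ℝ) / k * polySqfreeLevel g k (x / k) := by
  obtain ⟨hkI, hksq⟩ := Finset.mem_filter.1 hk
  have hk1 : 1 ≤ k := (Finset.mem_Icc.1 hkI).1
  have hk0 : 0 < k := hk1
  have hksq' : ∀ p : ℕ, p.Prime → p ∣ k → p ^ 2 ∣ k := fun p hp hpk =>
    hksq p (Nat.mem_primeFactors.2 ⟨hp, hpk, by omega⟩)
  -- `n / k = exactPart n` on the fibre
  have hex : ∀ n ∈ (Icc 1 x).filter (fun n => PowerfulPart.powerfulPart n = k),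
      n / k = PowerfulPart.exactPart n := by
    intro n hn
    obtain ⟨-, hnk⟩ := Finset.mem_filter.1 hn
    have h := PowerfulPart.powerfulPart_mul_exactPart n
    rw [hnk] at h
    exact Nat.div_eq_of_eq_mul_right hk0 h.symm
  unfold polySqfreeLevel
  rw [Finset.mul_sum]
  refine Finset.sum_nbij' (fun n => n / k) (fun u => k * u) ?_ ?_ ?_ ?_ ?_
  · intro n hn
    have he := hex n hn
    obtain ⟨hnI, hnk⟩ := Finset.mem_filter.1 hn
    obtain ⟨hn1, hnx⟩ := Finset.mem_Icc.1 hnI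
    refine Finset.mem_filter.2 ⟨Finset.mem_Icc.2 ⟨?_, Nat.div_le_div_right hnx⟩, ?_, ?_⟩
    · rw [he]
      exact PowerfulPart.exactPart_pos n
    · rw [he]
      exact PowerfulPart.squarefree_exactPart n
    · rw [he]
      have h := PowerfulPart.coprime_powerfulPart_exactPart n
      rw [hnk] at h
      exact h.symm
  · intro u hu
    rcases Finset.mem_filter.1 hu with ⟨huI, husq, huk⟩
    obtain ⟨hu1, hux⟩ := Finset.mem_Icc.1 huI
    refine Finset.mem_filter.2 ⟨Finset.mem_Icc.2 ⟨Nat.mul_pos hk0 hu1, ?_⟩,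
      PowerfulPart.powerfulPart_mul_eq hksq' husq huk.symm⟩
    have h := (Nat.le_div_iff_mul_le hk0).1 hux
    rw [mul_comm]
    exact h
  · intro n hn
    obtain ⟨-, hnk⟩ := Finset.mem_filter.1 hn
    exact Nat.mul_div_cancel' (hnk ▸ PowerfulPart.powerfulPart_dvd n)
  · intro u _
    exact Nat.mul_div_cancel_left u hk0
  · intro n hn
    obtain ⟨-, hnk⟩ := Finset.mem_filter.1 hn
    have hkn : k ∣ n := hnk ▸ PowerfulPart.powerfulPart_dvd n
    have hn_eq : n = k * (n / k) := (Nat.mul_div_cancel' hkn).symm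
    have hcop : k.Coprime (n / k) := by
      rw [hex n hn, ← hnk]
      exact PowerfulPart.coprime_powerfulPart_exactPart n
    have hρ : polyRootCountMod ![g] n = polyRootCountMod ![g] k * polyRootCountMod ![g] (n / k) := by
      conv_lhs => rw [hn_eq]
      exact polyRootCountMod_mul_of_coprime g hcop
    have hcast : (n : ℝ) = (k : ℝ) * ((n / k : ℕ) : ℝ) := by exact_mod_cast hn_eq
    rw [hρ, Nat.cast_mul, hcast, mul_div_mul_comm]

/-- **Squarefree · squarefull decomposition of the small level**:
`∑_{d ≤ x} ρ_g(d)/d = ∑_{k ≤ x squarefull} (ρ_g(k)/k) ∑_{u ≤ x/k, μ²=1, (u,k)=1} ρ_g(u)/u`.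
[this work] -/
theorem polySmallLevel_eq_sum_sqfull (g : ℤ[X]) (x : ℕ) :
    polySmallLevel g x =
      ∑ k ∈ (Icc 1 x).filter (fun k : ℕ => ∀ p ∈ k.primeFactors, p ^ 2 ∣ k),
        (polyRootCountMod ![g] k : ℝ) / k * polySqfreeLevel g k (x / k) := by
  unfold polySmallLevel
  rw [← Finset.sum_fiberwise_of_maps_to (fun n hn => powerfulPart_mem_filter_sqfull hn)
    (fun n => (polyRootCountMod ![g] n : ℝ) / n)]
  exact Finset.sum_congr rfl fun k hk => sum_fiber_powerfulPart_eq g hk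

/-! ### `log ⌊x/k⌋` versus `log x − log k` -/

/-- `|log ⌊x/k⌋ − (log x − log k)| ≤ log 2` for `1 ≤ k ≤ x`. [folklore] -/
theorem abs_log_nat_div_sub_le {x k : ℕ} (hk : 0 < k) (hkx : k ≤ x) :
    |Real.log ((x / k : ℕ) : ℝ) - (Real.log x - Real.log k)| ≤ Real.log 2 := by
  have hy1 : 1 ≤ x / k := (Nat.le_div_iff_mul_le hk).2 (by simpa using hkx)
  have hk0 : (0 : ℝ) < k := by exact_mod_cast hk
  have hx0 : (0 : ℝ) < x := by exact_mod_cast hk.trans_le hkx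
  have hyr : ((x / k : ℕ) : ℝ) ≤ (x : ℝ) / k := Nat.cast_div_le
  have hry : (x : ℝ) / k < ((x / k : ℕ) : ℝ) + 1 := by
    have h := Nat.lt_floor_add_one ((x : ℝ) / k)
    rw [Nat.floor_div_eq_div] at h
    exact h
  have hy1' : (1 : ℝ) ≤ ((x / k : ℕ) : ℝ) := by exact_mod_cast hy1
  have hy0 : (0 : ℝ) < ((x / k : ℕ) : ℝ) := by linarith
  have hr0 : (0 : ℝ) < (x : ℝ) / k := div_pos hx0 hk0
  rw [← Real.log_div hx0.ne' hk0.ne']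
  have h2 : (x : ℝ) / k ≤ 2 * ((x / k : ℕ) : ℝ) := by linarith
  rw [abs_sub_comm, abs_of_nonneg (by linarith [Real.log_le_log hy0 hyr]),
    ← Real.log_div hr0.ne' hy0.ne']
  apply Real.log_le_log (by positivity)
  rwa [div_le_iff₀ hy0]

end Summit.Parity.BatemanHorn.Theorems
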